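import Literature.Computability.AlgebraicComplexity.KIReductionLayout
import Literature.Computability.Complexity.FoldCatBricks
import HarnessLib

/-!
# Kabanets–Impagliazzo, Cor. 12: the reduction machine, I — operand, gate and block codes

Fifth file of the discharge of the reduction fact
`Literature.Computability.AlgebraicComplexity.permanent01Graph_polyExists_preimage_PIT`
(`PermanentGraphNSUBEXP.lean`): the polynomial-time machine writing the code word of the instance
`kiCircuit n M v P` (`KIReductionInstance.lean`, explicit form `KIReductionLayout.lean`) in the
`FP` string algebra of `BrickAlgebra.lean` / `FoldBricks.lean` / `FoldCatBricks.lean` (total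
string functions composed from `fanoutFn`, `iteFn`, the projections `fstF`/`sndF`, the numeral
bricks `addFn`/`lenBinF`, the tests `isNilFn`/`headBitFn`/`lenLeOneFn`, and the concatenation fold
`foldCat`). Every brick comes with (i) membership in `FP`, (ii) its value on well-formed records,
(iii) a structural output-length bound (for the unclipping side conditions of the folds above it).
This file writes the code of ONE use of a guessed gate list apart from its input layer:

* `opF ⟨bin (b+1), o⟩ = opCode ((readOp o).toOperand (b+1))` — the operand brick (a unary
  reference `⟨ε, u⟩` becomes the binary `1 · bin (b + 1 + |u|)`, the three constants their codes);
* `gateF ⟨bin (b+1), g⟩ = gateCode ((readGate g).toGate (b+1))` — the gate brick (kind dispatch on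
  the first field, the two operands, the sum/product skeletons of `gateCode_sum`/`gateCode_prod`);
* `frameF f = ⟨f ·, ε⟩` (an item of a list code), `blockPieceF`, and **`blockCodeF ⟨bin (b+1), Bs⟩ =
  encList (codes of the gates `(readBlock Bs).map (toGate (b+1))`)** — the block fold: one frame per
  item of `Bs`, by index (`nthItemFn`, `dropItemsFn`), empty pieces past the last item.

## References

* V. Kabanets, R. Impagliazzo, *Derandomizing polynomial identity tests means proving circuit
  lower bounds*, STOC 2003, Lemma 11 and proof of Cor. 12 (p. 358).
* S. Arora, B. Barak, *Computational Complexity: A Modern Approach*, CUP 2009, §1.3 (polynomial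
  time: composition, bounded loops).
-/

noncomputable section

namespace Literature.Computability.AlgebraicComplexity

namespace KIReduction

open _root_.Computability Complexity Brick OracleCompose HashBricks Plumb Polynomial ArithCircuit

/-! ### Small length facts -/

/-- `|lenBinF w| ≤ |w|` (by `length_encodeNat_le_self`, `StackNumeric.lean`). [folklore] -/
theorem length_lenBinF_le (w : List Bool) : (lenBinF w).length ≤ w.length := by
  rw [lenBinF_apply]; exact length_encodeNat_le_self _

/-- `|fstF z| ≤ |z|` (twin, outside this file's import cone: `Lemma3FP.length_fstF_le`,
`Complexity/SharpSATNormalFormFP.lean`). [folklore] -/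
theorem length_fstF_le' (z : List Bool) : (fstF z).length ≤ z.length := by
  have := length_fstF_sndF_le z; omega

/-- `|sndF z| ≤ |z|` (twin, outside this file's import cone: `Lemma3FP.length_sndF_le`,
`Complexity/SharpSATNormalFormFP.lean`). [folklore] -/
theorem length_sndF_le' (z : List Bool) : (sndF z).length ≤ z.length := by
  have := length_fstF_sndF_le z; omega

/-- `|nthItemFn ⟨u, W⟩| ≤ |W|` (twins, outside this file's import cone: `PPolyTuringClosure.lean`,
`GoldwasserSipserRefereeBricks.lean`, `Barriers/ValiantsHypothesis/KroneckerXRayMachineAdmissible.lean`; the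
natural home is next to `dropItemsFn` in `FoldCatBricks.lean`). [folklore] -/
theorem length_nthItemFn_boolPair_le (u W : List Bool) : (nthItemFn (boolPair u W)).length ≤ W.length := by
  rw [nthItemFn_boolPair]
  exact (length_fstF_le' _).trans (length_sndF_iterate_le _ _)

/-! ### The operand brick -/

/-- Code of the constant operand `1`. [folklore] -/
def oneOpCode : List Bool := false :: true :: intCode 1

/-- Code of the constant operand `-1`. [folklore] -/
def negOneOpCode : List Bool := false :: true :: intCode (-1)

/-- Code of the constant operand `0`. [folklore] -/
def zeroOpCode : List Bool := false :: true :: intCode 0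

/-- **The operand brick** on `⟨bin (b+1), o⟩`: empty class ⇒ `1 · bin (b + 1 + |u|)` (the
reference `gate (b + 1 + |u|)`), else the code of the constant read off the class. [cite: KabanetsImpagliazzo2003, proof of Cor. 12 (p. 358)] -/
def opF : List Bool → List Bool :=
  iteFn (isNilFn ∘ fstF ∘ sndF)
    (List.cons true ∘ addFn ∘ fanoutFn fstF (lenBinF ∘ sndF ∘ sndF))
    (iteFn (headBitFn ∘ fstF ∘ sndF) (fun _ => oneOpCode)
      (iteFn (lenLeOneFn ∘ fstF ∘ sndF) (fun _ => negOneOpCode) (fun _ => zeroOpCode)))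

/-- `opF ∈ FP`. [folklore] -/
theorem opF_mem_FP : opF ∈ FP :=
  iteFn_mem_FP (comp_mem_FP isNilFn_mem_FP (comp_mem_FP fstF_mem_FP sndF_mem_FP))
    (comp_mem_FP (cons_mem_FP true) (comp_mem_FP addFn_mem_FP
      (fanoutFn_mem_FP fstF_mem_FP (comp_mem_FP lenBinF_mem_FP (comp_mem_FP sndF_mem_FP sndF_mem_FP)))))
    (iteFn_mem_FP (comp_mem_FP headBitFn_mem_FP (comp_mem_FP fstF_mem_FP sndF_mem_FP)) (const_mem_FP _)
      (iteFn_mem_FP (comp_mem_FP lenLeOneFn_mem_FP (comp_mem_FP fstF_mem_FP sndF_mem_FP)) (const_mem_FP _) (const_mem_FP _)))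

/-- **Value of the operand brick**: the code of the realised operand read off `o`. [folklore] -/
theorem opF_apply (N b : ℕ) (o : List Bool) :
    opF (boolPair (encodeNat (b + 1)) o) = opCode N ((readOp o).toOperand (b + 1)) := by
  unfold opF readOp
  by_cases h1 : fstF o = []
  · rw [iteFn_apply_true (by simp [isNilFn, h1]), if_pos h1]
    simp [KOp.toOperand, Function.comp_apply, addFn_boolPair]
  · rw [iteFn_apply_false (by simp [isNilFn, h1]), if_neg h1]
    by_cases h2 : (fstF o).headD false = true
    · rw [iteFn_apply_true (by simp only [Function.comp_apply, sndF_boolPair, headBitFn_apply, h2]), if_pos h2]; rfl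
    · rw [iteFn_apply_false (by simp only [Function.comp_apply, sndF_boolPair, headBitFn_apply,
        eq_false_of_ne_true h2]), if_neg h2]
      by_cases h3 : (fstF o).length ≤ 1
      · rw [iteFn_apply_true (by simp [lenLeOneFn, h3]), if_pos h3]; rfl
      · rw [iteFn_apply_false (by simp [lenLeOneFn, h3]), if_neg h3]; rfl

/-- Length of an operand code in this run: `≤ |BIN| + |o| + 8`. [folklore] -/
theorem length_opF_le (b : ℕ) (o : List Bool) :
    (opF (boolPair (encodeNat (b + 1)) o)).length ≤ (encodeNat (b + 1)).length + o.length + 8 := by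
  unfold opF
  by_cases h1 : fstF o = []
  · rw [iteFn_apply_true (by simp [isNilFn, h1])]
    simp only [Function.comp_apply, fanoutFn_apply, fstF_boolPair, sndF_boolPair, List.length_cons]
    have h := length_addFn_le (boolPair (encodeNat (b + 1)) (lenBinF (sndF o)))
    simp only [fstF_boolPair, sndF_boolPair] at h
    have h2 := length_lenBinF_le (sndF o)
    have h3 := length_sndF_le' o
    omega
  · rw [iteFn_apply_false (by simp [isNilFn, h1])]
    by_cases h2 : (fstF o).headD false = true
    · rw [iteFn_apply_true (by simp only [Function.comp_apply, sndF_boolPair, headBitFn_apply, h2])]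
      simp [oneOpCode, intCode_one]
    · rw [iteFn_apply_false (by simp only [Function.comp_apply, sndF_boolPair, headBitFn_apply,
        eq_false_of_ne_true h2])]
      by_cases h3 : (fstF o).length ≤ 1
      · rw [iteFn_apply_true (by simp [lenLeOneFn, h3])]; simp [negOneOpCode, intCode_neg_one]
      · rw [iteFn_apply_false (by simp [lenLeOneFn, h3])]; simp [zeroOpCode, intCode_zero]

/-! ### The gate brick -/

/-- The first operand string of a gate string, paired with the numeral: `⟨BIN, fstF (sndF g)⟩`. [folklore] -/
def opArgA : List Bool → List Bool := fanoutFn fstF (fstF ∘ sndF ∘ sndF)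

/-- The second operand string of a gate string, paired with the numeral: `⟨BIN, sndF (sndF g)⟩`. [folklore] -/
def opArgB : List Bool → List Bool := fanoutFn fstF (sndF ∘ sndF ∘ sndF)

/-- The kind string of a gate string: `fstF g`. [folklore] -/
def kindArg : List Bool → List Bool := fstF ∘ sndF

/-- The skeleton of a binary sum gate with coefficients `c₁, c₂`:
`0 · ⟨11, ⟨⟨intCode c₁, opA⟩, ⟨⟨intCode c₂, opB⟩, ε⟩⟩⟩`. [folklore] -/
def sumSkelF (c₁ c₂ : ℤ) : List Bool → List Bool :=
  List.cons false ∘ fanoutFn (fun _ => [true, true])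
    (fanoutFn (fanoutFn (fun _ => intCode c₁) (opF ∘ opArgA))
      (fanoutFn (fanoutFn (fun _ => intCode c₂) (opF ∘ opArgB)) (fun _ => [])))

/-- The skeleton of a binary product gate: `1 · ⟨11, ⟨opA, ⟨opB, ε⟩⟩⟩`. [folklore] -/
def mulSkelF : List Bool → List Bool :=
  List.cons true ∘ fanoutFn (fun _ => [true, true]) (fanoutFn (opF ∘ opArgA) (fanoutFn (opF ∘ opArgB) (fun _ => [])))

/-- **The gate brick** on `⟨bin (b+1), g⟩`: dispatch on the kind string (`ε ↦ +`, `1… ↦ −`,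
`0 ↦ ×`, longer `0… ↦ −·−`, as `readKind`). [cite: KabanetsImpagliazzo2003, proof of Cor. 12 (p. 358)] -/
def gateF : List Bool → List Bool :=
  iteFn (isNilFn ∘ kindArg) (sumSkelF 1 1)
    (iteFn (headBitFn ∘ kindArg) (sumSkelF 1 (-1))
      (iteFn (lenLeOneFn ∘ kindArg) mulSkelF (sumSkelF (-1) (-1))))

/-- `opArgA ∈ FP`. [folklore] -/
theorem opArgA_mem_FP : opArgA ∈ FP :=
  fanoutFn_mem_FP fstF_mem_FP (comp_mem_FP fstF_mem_FP (comp_mem_FP sndF_mem_FP sndF_mem_FP))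

/-- `opArgB ∈ FP`. [folklore] -/
theorem opArgB_mem_FP : opArgB ∈ FP :=
  fanoutFn_mem_FP fstF_mem_FP (comp_mem_FP sndF_mem_FP (comp_mem_FP sndF_mem_FP sndF_mem_FP))

/-- `kindArg ∈ FP`. [folklore] -/
theorem kindArg_mem_FP : kindArg ∈ FP := comp_mem_FP fstF_mem_FP sndF_mem_FP

/-- `sumSkelF c₁ c₂ ∈ FP`. [folklore] -/
theorem sumSkelF_mem_FP (c₁ c₂ : ℤ) : sumSkelF c₁ c₂ ∈ FP :=
  comp_mem_FP (cons_mem_FP false) (fanoutFn_mem_FP (const_mem_FP _)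
    (fanoutFn_mem_FP (fanoutFn_mem_FP (const_mem_FP _) (comp_mem_FP opF_mem_FP opArgA_mem_FP))
      (fanoutFn_mem_FP (fanoutFn_mem_FP (const_mem_FP _) (comp_mem_FP opF_mem_FP opArgB_mem_FP)) (const_mem_FP _))))

/-- `mulSkelF ∈ FP`. [folklore] -/
theorem mulSkelF_mem_FP : mulSkelF ∈ FP :=
  comp_mem_FP (cons_mem_FP true) (fanoutFn_mem_FP (const_mem_FP _)
    (fanoutFn_mem_FP (comp_mem_FP opF_mem_FP opArgA_mem_FP) (fanoutFn_mem_FP (comp_mem_FP opF_mem_FP opArgB_mem_FP) (const_mem_FP _))))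

/-- `gateF ∈ FP`. [folklore] -/
theorem gateF_mem_FP : gateF ∈ FP :=
  iteFn_mem_FP (comp_mem_FP isNilFn_mem_FP kindArg_mem_FP) (sumSkelF_mem_FP 1 1)
    (iteFn_mem_FP (comp_mem_FP headBitFn_mem_FP kindArg_mem_FP) (sumSkelF_mem_FP 1 (-1))
      (iteFn_mem_FP (comp_mem_FP lenLeOneFn_mem_FP kindArg_mem_FP) mulSkelF_mem_FP (sumSkelF_mem_FP (-1) (-1))))

/-- `opArgA` on a record. [folklore] -/
@[simp] theorem opArgA_boolPair (B g : List Bool) : opArgA (boolPair B g) = boolPair B (fstF (sndF g)) := by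
  simp [opArgA]

/-- `opArgB` on a record. [folklore] -/
@[simp] theorem opArgB_boolPair (B g : List Bool) : opArgB (boolPair B g) = boolPair B (sndF (sndF g)) := by
  simp [opArgB]

/-- `kindArg` on a record. [folklore] -/
@[simp] theorem kindArg_boolPair (B g : List Bool) : kindArg (boolPair B g) = fstF g := by simp [kindArg]

/-- Value of the sum skeleton: the code of `c₁ • a + c₂ • b`. [folklore] -/
theorem sumSkelF_apply (N b : ℕ) (c₁ c₂ : ℤ) (g : List Bool) :
    sumSkelF c₁ c₂ (boolPair (encodeNat (b + 1)) g) =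
      gateCode N (.sum [(c₁, (readOp (fstF (sndF g))).toOperand (b + 1)), (c₂, (readOp (sndF (sndF g))).toOperand (b + 1))]) := by
  rw [gateCode_sum]
  simp [sumSkelF, opF_apply N, ones, encList_cons]

/-- Value of the product skeleton: the code of `a · b`. [folklore] -/
theorem mulSkelF_apply (N b : ℕ) (g : List Bool) :
    mulSkelF (boolPair (encodeNat (b + 1)) g) =
      gateCode N (.prod [(readOp (fstF (sndF g))).toOperand (b + 1), (readOp (sndF (sndF g))).toOperand (b + 1)]) := by
  rw [gateCode_prod]
  simp [mulSkelF, opF_apply N, ones, encList_cons]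

/-- **Value of the gate brick**: the code of the realised gate read off `g`. [folklore] -/
theorem gateF_apply (N b : ℕ) (g : List Bool) :
    gateF (boolPair (encodeNat (b + 1)) g) = gateCode N ((readGate g).toGate (b + 1)) := by
  unfold gateF readGate readKind
  by_cases h1 : fstF g = []
  · rw [iteFn_apply_true (by simp [isNilFn, h1]), if_pos h1, sumSkelF_apply N]; rfl
  · rw [iteFn_apply_false (by simp [isNilFn, h1]), if_neg h1]
    by_cases h2 : (fstF g).headD false = true
    · rw [iteFn_apply_true (by simp only [Function.comp_apply, kindArg_boolPair, headBitFn_apply, h2]), if_pos h2,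
        sumSkelF_apply N]; rfl
    · rw [iteFn_apply_false (by simp only [Function.comp_apply, kindArg_boolPair, headBitFn_apply, eq_false_of_ne_true h2]),
        if_neg h2]
      by_cases h3 : (fstF g).length ≤ 1
      · rw [iteFn_apply_true (by simp [lenLeOneFn, h3]), if_pos h3, mulSkelF_apply N]; rfl
      · rw [iteFn_apply_false (by simp [lenLeOneFn, h3]), if_neg h3, sumSkelF_apply N]; rfl

/-- Length of the two operand codes of a gate string: `≤ 2 |BIN| + |g| + 16`. [folklore] -/
theorem length_opF_args_le (b : ℕ) (g : List Bool) :
    (opF (boolPair (encodeNat (b + 1)) (fstF (sndF g)))).length +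
        (opF (boolPair (encodeNat (b + 1)) (sndF (sndF g)))).length ≤ 2 * (encodeNat (b + 1)).length + g.length + 16 := by
  have h1 := length_opF_le b (fstF (sndF g))
  have h2 := length_opF_le b (sndF (sndF g))
  have h3 := length_fstF_sndF_le (sndF g)
  have h4 := length_sndF_le' g
  omega

/-- Length of a gate code in this run: `≤ 4 |BIN| + 2 |g| + 100`. [folklore] -/
theorem length_gateF_le (b : ℕ) (g : List Bool) :
    (gateF (boolPair (encodeNat (b + 1)) g)).length ≤ 4 * (encodeNat (b + 1)).length + 2 * g.length + 100 := by
  have h := length_opF_args_le b g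
  have hsum : ∀ c₁ c₂ : ℤ, (intCode c₁).length ≤ 5 → (intCode c₂).length ≤ 5 →
      (sumSkelF c₁ c₂ (boolPair (encodeNat (b + 1)) g)).length ≤ 4 * (encodeNat (b + 1)).length + 2 * g.length + 100 := by
    intro c₁ c₂ hc₁ hc₂
    simp only [sumSkelF, Function.comp_apply, fanoutFn_apply, opArgA_boolPair, opArgB_boolPair, List.length_cons,
      length_boolPair, List.length_nil]
    omega
  have hmul : (mulSkelF (boolPair (encodeNat (b + 1)) g)).length ≤ 4 * (encodeNat (b + 1)).length + 2 * g.length + 100 := by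
    simp only [mulSkelF, Function.comp_apply, fanoutFn_apply, opArgA_boolPair, opArgB_boolPair, List.length_cons,
      length_boolPair, List.length_nil]
    omega
  have i1 : (intCode 1).length ≤ 5 := by simp [intCode_one]
  have i2 : (intCode (-1)).length ≤ 5 := by simp [intCode_neg_one]
  unfold gateF
  by_cases h1 : fstF g = []
  · rw [iteFn_apply_true (by simp [isNilFn, h1])]; exact hsum 1 1 i1 i1
  · rw [iteFn_apply_false (by simp [isNilFn, h1])]
    by_cases h2 : (fstF g).headD false = true
    · rw [iteFn_apply_true (by simp only [Function.comp_apply, kindArg_boolPair, headBitFn_apply, h2])]; exact hsum 1 (-1) i1 i2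
    · rw [iteFn_apply_false (by simp only [Function.comp_apply, kindArg_boolPair, headBitFn_apply, eq_false_of_ne_true h2])]
      by_cases h3 : (fstF g).length ≤ 1
      · rw [iteFn_apply_true (by simp [lenLeOneFn, h3])]; exact hmul
      · rw [iteFn_apply_false (by simp [lenLeOneFn, h3])]; exact hsum (-1) (-1) i2 i2

/-! ### Frames and the block fold -/

/-- The frame of a piece: `frameF f z = ⟨f z, ε⟩` (an item of a list code; twin, outside this file's import
cone: `Ladder3.frameF`, `Complexity/ParsimoniousThreeCNFMachine.lean`). [folklore] -/
def frameF (f : List Bool → List Bool) : List Bool → List Bool := fanoutFn f (fun _ => [])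

/-- Value of a frame. [folklore] -/
@[simp] theorem frameF_apply (f : List Bool → List Bool) (z : List Bool) : frameF f z = boolPair (f z) [] := by
  simp [frameF]

/-- `frameF f ∈ FP`. [folklore] -/
theorem frameF_mem_FP {f : List Bool → List Bool} (hf : f ∈ FP) : frameF f ∈ FP := fanoutFn_mem_FP hf (const_mem_FP _)

/-- Length of a frame: `2 |f z| + 2`. [folklore] -/
theorem length_frameF (f : List Bool → List Bool) (z : List Bool) : (frameF f z).length = 2 * (f z).length + 2 := by
  rw [frameF_apply, length_boolPair]; simp

/-- **The block piece** on `⟨⟨BIN, Bs⟩, 1ᵗ⟩`: if fewer than `t + 1` items remain, nothing; else the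
frame of the code of item `t`. [cite: KabanetsImpagliazzo2003, proof of Cor. 12 (p. 358)] -/
def blockPieceF : List Bool → List Bool :=
  iteFn (isNilFn ∘ dropItemsFn ∘ fanoutFn sndF (sndF ∘ fstF)) (fun _ => [])
    (frameF (gateF ∘ fanoutFn (fstF ∘ fstF) (nthItemFn ∘ fanoutFn sndF (sndF ∘ fstF))))

/-- `blockPieceF ∈ FP`. [folklore] -/
theorem blockPieceF_mem_FP : blockPieceF ∈ FP :=
  iteFn_mem_FP (comp_mem_FP isNilFn_mem_FP (comp_mem_FP dropItemsFn_mem_FP (fanoutFn_mem_FP sndF_mem_FP (comp_mem_FP sndF_mem_FP fstF_mem_FP))))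
    (const_mem_FP _)
    (frameF_mem_FP (comp_mem_FP gateF_mem_FP (fanoutFn_mem_FP (comp_mem_FP fstF_mem_FP fstF_mem_FP)
      (comp_mem_FP nthItemFn_mem_FP (fanoutFn_mem_FP sndF_mem_FP (comp_mem_FP sndF_mem_FP fstF_mem_FP))))))

/-- **Value of the block piece** past the last item: nothing. [folklore] -/
theorem blockPieceF_apply_of_le (B Bs : List Bool) {t : ℕ} (ht : (readList Bs).length ≤ t) :
    blockPieceF (boolPair (boolPair B Bs) (ones t)) = [] := by
  unfold blockPieceF
  rw [iteFn_apply_true]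
  simp [isNilFn, ones, iterate_sndF_eq_nil Bs ht]

/-- **Value of the block piece** at an item: the frame of the code of the realised gate. [folklore] -/
theorem blockPieceF_apply_of_lt (N b : ℕ) (Bs : List Bool) {t : ℕ} (ht : t < (readList Bs).length) :
    blockPieceF (boolPair (boolPair (encodeNat (b + 1)) Bs) (ones t)) =
      boolPair (gateCode N ((readGate ((readList Bs).getD t [])).toGate (b + 1))) [] := by
  have hne : sndF^[t] Bs ≠ [] := iterate_sndF_ne_nil Bs ht
  unfold blockPieceF
  rw [iteFn_apply_false (by simp [isNilFn, ones, hne])]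
  simp only [frameF_apply, Function.comp_apply, fanoutFn_apply, fstF_boolPair, sndF_boolPair, nthItemFn_boolPair, ones,
    List.length_replicate, ← getD_readList, gateF_apply N]

/-- Length of the block piece: `≤ 8 |BIN| + 4 |Bs| + 202`. [folklore] -/
theorem length_blockPieceF_le (b : ℕ) (Bs : List Bool) (t : ℕ) :
    (blockPieceF (boolPair (boolPair (encodeNat (b + 1)) Bs) (ones t))).length ≤
      8 * (encodeNat (b + 1)).length + 4 * Bs.length + 202 := by
  unfold blockPieceF
  rw [iteFn_of_oneBit (oneBit_isNilFn.comp _)]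
  split_ifs
  · simp
  · rw [length_frameF]
    simp only [Function.comp_apply, fanoutFn_apply, fstF_boolPair, sndF_boolPair]
    have h1 := length_gateF_le b (nthItemFn (boolPair (ones t) Bs))
    have h2 := length_nthItemFn_boolPair_le (ones t) Bs
    omega

/-- The clip polynomial of the block fold: pieces `≤ 8 |x| + 4 |x| + 202` on the context
`x = ⟨BIN, Bs⟩` (`|Bs|` rounds). [folklore] -/
def blockQ : Polynomial ℕ := 12 * X + 202

/-- **The block brick**: `⟨BIN, Bs⟩ ↦` the block fold over `|Bs|` rounds. [cite: KabanetsImpagliazzo2003, proof of Cor. 12 (p. 358)] -/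
def blockCodeF : List Bool → List Bool := foldCat blockQ X blockPieceF ∘ fanoutFn id sndF

/-- `blockCodeF ∈ FP`. [folklore] -/
theorem blockCodeF_mem_FP : blockCodeF ∈ FP :=
  comp_mem_FP (foldCat_mem_FP _ _ blockPieceF_mem_FP) (fanoutFn_mem_FP id_mem_FP sndF_mem_FP)

/-- Mapping over the items by index is mapping over the items (generalises `map_getD_range`,
`Cryptography/ImpagliazzoLevinAnalysis.lean` / `QuantumComplexity/AKSMachinePow.lean`, outside this
file's import cone). [folklore] -/
theorem map_range_getD {α β : Type} (l : List α) (d : α) (f : α → β) :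
    (List.range l.length).map (fun t => f (l.getD t d)) = l.map f := by
  apply List.ext_getElem (by simp)
  intro i h₁ h₂
  simp only [List.length_map, List.length_range] at h₁
  simp [List.getElem_range, List.getD_eq_getElem?_getD, List.getElem?_eq_getElem h₁]

/-- **Value of the block brick**: the list code of the codes of the realised gates of
`readBlock Bs` — exactly the items that `encodeArithCircuit` writes for these gates. [cite: KabanetsImpagliazzo2003, proof of Cor. 12 (p. 358)] -/
theorem blockCodeF_apply (N b : ℕ) (Bs : List Bool) :
    blockCodeF (boolPair (encodeNat (b + 1)) Bs) =
      encList (((readBlock Bs).map (KGate.toGate (b + 1))).map (gateCode N)) := by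
  rw [blockCodeF, Function.comp_apply, fanoutFn_apply, id, sndF_boolPair]
  rw [foldCat_apply (p := X) (by simp) (fun t _ => ?_)]
  · rw [ccat_eq_ccat_of_eq_nil (length_readList_le Bs) (fun t ht _ => blockPieceF_apply_of_le _ _ ht),
      ccat_congr (fun t ht => blockPieceF_apply_of_lt N b Bs ht), ccat_frame_eq_encList,
      map_range_getD (readList Bs) [] (fun g => gateCode N ((readGate g).toGate (b + 1)))]
    simp [readBlock, List.map_map, Function.comp_def]
  · refine (length_blockPieceF_le b Bs t).trans ?_
    simp only [blockQ, Polynomial.eval_add, Polynomial.eval_mul, Polynomial.eval_ofNat, Polynomial.eval_X, length_boolPair]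
    omega

/-- Length of the block code: `≤ |Bs| · (12 |⟨BIN, Bs⟩| + 202)`. [folklore] -/
theorem length_blockCodeF_le (b : ℕ) (Bs : List Bool) :
    (blockCodeF (boolPair (encodeNat (b + 1)) Bs)).length ≤
      Bs.length * (12 * (boolPair (encodeNat (b + 1)) Bs).length + 202) := by
  rw [blockCodeF, Function.comp_apply, fanoutFn_apply, id, sndF_boolPair]
  have hQ : ∀ t, t < Bs.length → (blockPieceF (boolPair (boolPair (encodeNat (b + 1)) Bs) (ones t))).length ≤
      blockQ.eval (boolPair (encodeNat (b + 1)) Bs).length := fun t _ => by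
    refine (length_blockPieceF_le b Bs t).trans ?_
    simp only [blockQ, Polynomial.eval_add, Polynomial.eval_mul, Polynomial.eval_ofNat, Polynomial.eval_X, length_boolPair]
    omega
  rw [foldCat_apply (p := X) (by simp) hQ]
  refine length_ccat_le' Bs.length fun t ht => (hQ t ht).trans ?_
  simp [blockQ]

end KIReduction

end Literature.Computability.AlgebraicComplexity

end
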